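import Mathlib

/-!
# Tier3IwasawaFiltration — the coefficient filtration of `O⟦X⟧` and its limits (the device behind the LIMIT of Lang's
Theorem 1.1; `Tier3IwasawaLimit` applies it)

Blind re-derivation cell `pub-hodge-repro`, seat `t3-p3` (Tier 3, T3.2 «(R2) ∧ (R1) — the pinning»; T3.5 Lean item beside
it). Target tree path `lean/Summits/Ventures/HodgeRepro/Tier3IwasawaFiltration.lean`; imports Mathlib only; theorems only
(no definition, instance, notation or macro).

WHAT THIS FILE STATES. For a commutative ring `A` and an ideal `I`, the filtration `𝔉_k = {f ∈ A⟦X⟧ : coeff_j f ∈ I^{k−j}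
for all j}` (`I^{k−j} = A` once `j ≥ k`, by natural subtraction) — written out as the predicate
`∀ j, PowerSeries.coeff j f ∈ I ^ (k - j)` rather than as a definition — is the `(I, X)`-adic filtration in the form the
proof of Lang's Theorem 1.1 (GTM 121 Ch. 5 §1, p. 124: «`ε : ℤ_p⟦X⟧ → lim ℤ_p[X]/(h_n)` is an isomorphism») uses:

* §1 `𝔉_k` is decreasing in `k`, closed under sums, `𝔉_a · 𝔉_b ⊆ 𝔉_{a+b}` (`coeff_mul_mem_pow_sub`), `X ∈ 𝔉_1`, a constant
  of `I^k` lies in `𝔉_k`, `∑_{i<p} (1 + z)^i ∈ 𝔉_1` for `z ∈ 𝔉_1` and `p ∈ I` (`coeff_geomSum_one_add_mem_pow_sub_one`: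
  the sum is `p + ∑_{i<p} ((1 + z)^i − 1)`), hence with `h_{n+1} = h_n · ∑_{i<p} (1 + h_n)^i` for `h_n = (X + 1)^{p^n} − 1`
  (`X_add_one_pow_prime_pow_succ_sub_one_eq`): **`h_n ∈ 𝔉_{n+1}`** (`coeff_X_add_one_pow_prime_pow_sub_one_mem`) and
  **`h_{n+i} = h_n · g_i` with `g_i ∈ 𝔉_i`** (`exists_mul_eq_X_add_one_pow_prime_pow_add_sub_one`);
* §2 limits: a sequence with `F_n − F_m ∈ 𝔉_m` for `m ≤ n` has a limit `L` with `L − F_n ∈ 𝔉_n` for every `n`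
  (`exists_forall_coeff_sub_mem_pow_sub` — coefficientwise, from `IsPrecomplete I A`), such a limit is unique
  (`eq_of_forall_coeff_sub_mem_pow_sub` — from `IsHausdorff I A`), and consecutive differences in `𝔉_{s k}` (`s` monotone)
  telescope to `F_n − F_m ∈ 𝔉_{s m}` (`coeff_sub_mem_pow_sub_of_succ`).

HONESTY. Pure commutative algebra on Mathlib's `IsPrecomplete` / `IsHausdorff`; nothing here names a printed theorem —
the sentence it serves (Lang Thm 1.1, the LIMIT) is stated and proved in `Tier3IwasawaLimit`. No verdict / residue /
label / row of route/TIER3.md §3 moves. HC_CM is NOT proved by anyone in this repository.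
-/

set_option autoImplicit false

open Polynomial
open scoped PowerSeries

namespace Summit.Ventures.HodgeRepro.T3.R2Pinning

/-! ### §1 The coefficient filtration `𝔉_k(I) = {f : coeff j f ∈ I^(k − j) for all j}` -/

section Filtration

variable {A : Type*} [CommRing A] {I : Ideal A}

/-- `𝔉_k ⊆ 𝔉_{k'}` for `k' ≤ k`. -/
theorem coeff_mem_pow_sub_of_le {k k' : ℕ} (hk : k' ≤ k) {f : A⟦X⟧}
    (hf : ∀ j, PowerSeries.coeff j f ∈ I ^ (k - j)) (j : ℕ) : PowerSeries.coeff j f ∈ I ^ (k' - j) :=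
  Ideal.pow_le_pow_right (Nat.sub_le_sub_right hk j) (hf j)

/-- `0 ∈ 𝔉_k`. -/
theorem coeff_zero_mem_pow_sub (k j : ℕ) : PowerSeries.coeff j (0 : A⟦X⟧) ∈ I ^ (k - j) := by
  rw [map_zero]
  exact Submodule.zero_mem _

/-- `𝔉_k` is closed under addition. -/
theorem coeff_add_mem_pow_sub {k : ℕ} {f g : A⟦X⟧} (hf : ∀ j, PowerSeries.coeff j f ∈ I ^ (k - j))
    (hg : ∀ j, PowerSeries.coeff j g ∈ I ^ (k - j)) (j : ℕ) :
    PowerSeries.coeff j (f + g) ∈ I ^ (k - j) := by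
  rw [map_add]
  exact Ideal.add_mem _ (hf j) (hg j)

/-- `𝔉_k` is closed under subtraction. -/
theorem coeff_sub_mem_pow_sub {k : ℕ} {f g : A⟦X⟧} (hf : ∀ j, PowerSeries.coeff j f ∈ I ^ (k - j))
    (hg : ∀ j, PowerSeries.coeff j g ∈ I ^ (k - j)) (j : ℕ) :
    PowerSeries.coeff j (f - g) ∈ I ^ (k - j) := by
  rw [map_sub]
  exact Ideal.sub_mem _ (hf j) (hg j)

/-- `𝔉_k` is closed under finite sums. -/
theorem coeff_sum_mem_pow_sub {k : ℕ} {ι : Type*} (s : Finset ι) {f : ι → A⟦X⟧}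
    (hf : ∀ i ∈ s, ∀ j, PowerSeries.coeff j (f i) ∈ I ^ (k - j)) (j : ℕ) :
    PowerSeries.coeff j (∑ i ∈ s, f i) ∈ I ^ (k - j) := by
  rw [map_sum]
  exact Ideal.sum_mem _ fun i hi => hf i hi j

/-- **`𝔉_a · 𝔉_b ⊆ 𝔉_{a+b}`**: the `j`-th coefficient of a product is the sum over `i + l = j` of products of
coefficients, each in `I^{a−i} · I^{b−l} ⊆ I^{a+b−j}`. -/
theorem coeff_mul_mem_pow_sub {a b : ℕ} {f g : A⟦X⟧} (hf : ∀ j, PowerSeries.coeff j f ∈ I ^ (a - j))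
    (hg : ∀ j, PowerSeries.coeff j g ∈ I ^ (b - j)) (j : ℕ) :
    PowerSeries.coeff j (f * g) ∈ I ^ (a + b - j) := by
  rw [PowerSeries.coeff_mul]
  refine Ideal.sum_mem _ fun x hx => ?_
  have hx' : x.1 + x.2 = j := Finset.HasAntidiagonal.mem_antidiagonal.mp hx
  have h1 : PowerSeries.coeff x.1 f * PowerSeries.coeff x.2 g ∈ I ^ (a - x.1) * I ^ (b - x.2) :=
    Ideal.mul_mem_mul (hf x.1) (hg x.2)
  rw [← pow_add] at h1
  exact Ideal.pow_le_pow_right (by omega) h1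

/-- `𝔉_a` is an ideal: `f ∈ 𝔉_a ⇒ f · g ∈ 𝔉_a`. -/
theorem coeff_mul_mem_pow_sub_left {a : ℕ} {f : A⟦X⟧} (hf : ∀ j, PowerSeries.coeff j f ∈ I ^ (a - j))
    (g : A⟦X⟧) (j : ℕ) : PowerSeries.coeff j (f * g) ∈ I ^ (a - j) := by
  have hg : ∀ j, PowerSeries.coeff j g ∈ I ^ (0 - j) := fun j => by
    rw [Nat.zero_sub, pow_zero, Ideal.one_eq_top]
    exact Submodule.mem_top
  have := coeff_mul_mem_pow_sub hf hg j
  rwa [Nat.add_zero] at this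

/-- `𝔉_a` is an ideal: `f ∈ 𝔉_a ⇒ g · f ∈ 𝔉_a`. -/
theorem coeff_mul_mem_pow_sub_right {a : ℕ} {f : A⟦X⟧} (hf : ∀ j, PowerSeries.coeff j f ∈ I ^ (a - j))
    (g : A⟦X⟧) (j : ℕ) : PowerSeries.coeff j (g * f) ∈ I ^ (a - j) := by
  rw [mul_comm]
  exact coeff_mul_mem_pow_sub_left hf g j

/-- `X ∈ 𝔉_1`. -/
theorem coeff_X_mem_pow_sub_one (j : ℕ) : PowerSeries.coeff j (PowerSeries.X : A⟦X⟧) ∈ I ^ (1 - j) := by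
  rw [PowerSeries.coeff_X]
  rcases j with _ | j
  · simp
  · rw [Nat.sub_eq_zero_of_le (by omega), pow_zero, Ideal.one_eq_top]
    exact Submodule.mem_top

/-- A constant `a ∈ I^k` lies in `𝔉_k`. -/
theorem coeff_C_mem_pow_sub {k : ℕ} {a : A} (ha : a ∈ I ^ k) (j : ℕ) :
    PowerSeries.coeff j (PowerSeries.C a : A⟦X⟧) ∈ I ^ (k - j) := by
  rw [PowerSeries.coeff_C]
  split_ifs with hj
  · subst hj
    simpa using ha
  · exact Submodule.zero_mem _

/-- A natural number `m` with `m ∈ I` lies in `𝔉_1`. -/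
theorem coeff_natCast_mem_pow_sub_one {m : ℕ} (hm : (m : A) ∈ I) (j : ℕ) :
    PowerSeries.coeff j (m : A⟦X⟧) ∈ I ^ (1 - j) := by
  rw [← map_natCast (PowerSeries.C (R := A)) m]
  exact coeff_C_mem_pow_sub (by simpa using hm) j

/-- **`∑_{i<p} (1 + z)^i ∈ 𝔉_1`** for `z ∈ 𝔉_1` and `p ∈ I`: the sum is `p + ∑_{i<p} ((1 + z)^i − 1)` with each
`(1 + z)^i − 1` a multiple of `z`. -/
theorem coeff_geomSum_one_add_mem_pow_sub_one {p : ℕ} (hp : (p : A) ∈ I) {z : A⟦X⟧}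
    (hz : ∀ j, PowerSeries.coeff j z ∈ I ^ (1 - j)) (j : ℕ) :
    PowerSeries.coeff j (∑ i ∈ Finset.range p, (1 + z) ^ i) ∈ I ^ (1 - j) := by
  have hsum : (∑ i ∈ Finset.range p, (1 + z) ^ i) =
      (∑ i ∈ Finset.range p, ((1 + z) ^ i - 1)) + (p : A⟦X⟧) := by
    rw [Finset.sum_sub_distrib, Finset.sum_const, Finset.card_range, nsmul_eq_mul, mul_one, sub_add_cancel]
  rw [hsum]
  refine coeff_add_mem_pow_sub (fun j => ?_) (coeff_natCast_mem_pow_sub_one hp) j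
  refine coeff_sum_mem_pow_sub _ (fun i _ j => ?_) j
  obtain ⟨c, hc⟩ := sub_one_dvd_pow_sub_one (1 + z) i
  rw [add_sub_cancel_left] at hc
  rw [hc]
  exact coeff_mul_mem_pow_sub_left hz c j

/-- `h_n` as a power series: `((X + 1)^m − 1 : A[X])` coerces to `(X + 1)^m − 1` in `A⟦X⟧`. -/
theorem coe_X_add_one_pow_sub_one (m : ℕ) :
    ((((X + 1) ^ m - 1 : A[X])) : A⟦X⟧) = (PowerSeries.X + 1) ^ m - 1 := by
  simp only [Polynomial.coe_sub, Polynomial.coe_pow, Polynomial.coe_add, Polynomial.coe_X, Polynomial.coe_one]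

/-- **`h_{n+1} = h_n · ∑_{i<p} (1 + h_n)^i`** (the geometric sum: `(x − 1) · ∑_{i<p} x^i = x^p − 1` with `x = (X + 1)^{p^n}`). -/
theorem X_add_one_pow_prime_pow_succ_sub_one_eq (p n : ℕ) :
    ((PowerSeries.X + 1) ^ p ^ (n + 1) - 1 : A⟦X⟧) =
      ((PowerSeries.X + 1) ^ p ^ n - 1) * ∑ i ∈ Finset.range p, (1 + ((PowerSeries.X + 1) ^ p ^ n - 1)) ^ i := by
  rw [add_sub_cancel, mul_geom_sum, ← pow_mul, ← pow_succ]

/-- **`h_n ∈ 𝔉_{n+1}`**: `h_0 = X ∈ 𝔉_1`, and `h_{n+1} = h_n · ∑_{i<p} (1 + h_n)^i ∈ 𝔉_{n+1} · 𝔉_1`. -/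
theorem coeff_X_add_one_pow_prime_pow_sub_one_mem {p : ℕ} (hp : (p : A) ∈ I) (n j : ℕ) :
    PowerSeries.coeff j ((PowerSeries.X + 1) ^ p ^ n - 1 : A⟦X⟧) ∈ I ^ (n + 1 - j) := by
  induction n generalizing j with
  | zero =>
    rw [pow_zero, pow_one, add_sub_cancel_right]
    exact coeff_X_mem_pow_sub_one j
  | succ n ih =>
    rw [X_add_one_pow_prime_pow_succ_sub_one_eq]
    exact coeff_mul_mem_pow_sub ih
      (coeff_geomSum_one_add_mem_pow_sub_one hp (coeff_mem_pow_sub_of_le (by omega) ih)) j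

/-- **`h_{n+i} = h_n · g_i` with `g_i ∈ 𝔉_i`** (`g_0 = 1`, `g_{i+1} = g_i · ∑_{l<p} (1 + h_{n+i})^l`). -/
theorem exists_mul_eq_X_add_one_pow_prime_pow_add_sub_one {p : ℕ} (hp : (p : A) ∈ I) (n i : ℕ) :
    ∃ g : A⟦X⟧, (∀ j, PowerSeries.coeff j g ∈ I ^ (i - j)) ∧
      ((PowerSeries.X + 1) ^ p ^ (n + i) - 1 : A⟦X⟧) = ((PowerSeries.X + 1) ^ p ^ n - 1) * g := by
  induction i with
  | zero =>
    refine ⟨1, fun j => ?_, by rw [Nat.add_zero, mul_one]⟩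
    rw [Nat.zero_sub, pow_zero, Ideal.one_eq_top]
    exact Submodule.mem_top
  | succ i ih =>
    obtain ⟨g, hg, hg'⟩ := ih
    refine ⟨g * ∑ l ∈ Finset.range p, (1 + ((PowerSeries.X + 1) ^ p ^ (n + i) - 1)) ^ l, fun j => ?_, ?_⟩
    · exact coeff_mul_mem_pow_sub hg
        (coeff_geomSum_one_add_mem_pow_sub_one hp
          (coeff_mem_pow_sub_of_le (by omega) (coeff_X_add_one_pow_prime_pow_sub_one_mem hp (n + i)))) j
    · rw [← Nat.add_assoc, X_add_one_pow_prime_pow_succ_sub_one_eq, hg', mul_assoc]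

end Filtration

/-! ### §2 Limits for the filtration: Cauchy sequences converge (`IsPrecomplete`), limits are unique (`IsHausdorff`) -/

section Limits

variable {A : Type*} [CommRing A] {I : Ideal A}

/-- **Cauchy sequences for the filtration converge**: if `F_n − F_m ∈ 𝔉_m` for `m ≤ n`, there is `L` with
`L − F_n ∈ 𝔉_n` for every `n` — coefficientwise, the `j`-th coefficients of `F_{k+j}` form an `I`-adic Cauchy
sequence in `A`, which converges since `A` is `I`-adically precomplete. -/
theorem exists_forall_coeff_sub_mem_pow_sub [IsPrecomplete I A] (F : ℕ → A⟦X⟧)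
    (hF : ∀ m n, m ≤ n → ∀ j, PowerSeries.coeff j (F n - F m) ∈ I ^ (m - j)) :
    ∃ L : A⟦X⟧, ∀ n j, PowerSeries.coeff j (L - F n) ∈ I ^ (n - j) := by
  have key : ∀ j : ℕ, ∃ l : A, ∀ k : ℕ,
      PowerSeries.coeff j (F (k + j)) ≡ l [SMOD (I ^ k • ⊤ : Submodule A A)] := by
    intro j
    refine IsPrecomplete.prec' (I := I) (fun k => PowerSeries.coeff j (F (k + j))) ?_
    intro m n hmn
    rw [SModEq.sub_mem, smul_eq_mul, Ideal.mul_top]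
    have := hF (m + j) (n + j) (by omega) j
    rw [Nat.add_sub_cancel] at this
    rw [← neg_sub, ← map_sub]
    exact Submodule.neg_mem _ this
  choose L hL using key
  refine ⟨PowerSeries.mk L, fun n j => ?_⟩
  have h1 := hL j n
  rw [SModEq.sub_mem, smul_eq_mul, Ideal.mul_top] at h1
  have h2 := hF n (n + j) (by omega) j
  rw [map_sub, PowerSeries.coeff_mk]
  have : L j - PowerSeries.coeff j (F n) =
      -(PowerSeries.coeff j (F (n + j)) - L j) + PowerSeries.coeff j (F (n + j) - F n) := by
    rw [map_sub]
    ring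
  rw [this]
  exact Ideal.add_mem _ (Submodule.neg_mem _ (Ideal.pow_le_pow_right (Nat.sub_le n j) h1)) h2

/-- **Limits are unique**: `f − g ∈ 𝔉_n` for every `n` forces `f = g` — each coefficient of `f − g` lies in every
`I^k`, and `A` is `I`-adically Hausdorff. -/
theorem eq_of_forall_coeff_sub_mem_pow_sub [IsHausdorff I A] {f g : A⟦X⟧}
    (h : ∀ n j, PowerSeries.coeff j (f - g) ∈ I ^ (n - j)) : f = g := by
  rw [← sub_eq_zero]
  ext j
  rw [map_zero]
  refine IsHausdorff.haus' (I := I) _ fun k => ?_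
  rw [SModEq.zero, smul_eq_mul, Ideal.mul_top]
  have := h (k + j) j
  rwa [Nat.add_sub_cancel] at this

/-- **Telescoping**: if consecutive differences `F_{k+1} − F_k` lie in `𝔉_{s k}` with `s` monotone, then
`F_n − F_m ∈ 𝔉_{s m}` for all `m ≤ n`. -/
theorem coeff_sub_mem_pow_sub_of_succ {s : ℕ → ℕ} (hs : ∀ k, s k ≤ s (k + 1)) (F : ℕ → A⟦X⟧)
    (hF : ∀ k j, PowerSeries.coeff j (F (k + 1) - F k) ∈ I ^ (s k - j)) (m n : ℕ) (hmn : m ≤ n) (j : ℕ) :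
    PowerSeries.coeff j (F n - F m) ∈ I ^ (s m - j) := by
  have hmono : Monotone s := monotone_nat_of_le_succ hs
  induction n, hmn using Nat.le_induction generalizing j with
  | base =>
    rw [sub_self]
    exact coeff_zero_mem_pow_sub _ j
  | succ n hmn ih =>
    have : F (n + 1) - F m = (F (n + 1) - F n) + (F n - F m) := by ring
    rw [this]
    exact coeff_add_mem_pow_sub (coeff_mem_pow_sub_of_le (hmono hmn) (hF n)) ih j

end Limits

end Summit.Ventures.HodgeRepro.T3.R2Pinning
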